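import Literature.AnabelianGeometry.AbsoluteAnabelian.AbsTopIProp23ClosedSurfaceModelProofs
import Literature.AnabelianGeometry.AbsoluteAnabelian.AbsTopIProp23PuncturedSurfaceModelProofs
import Literature.AnabelianGeometry.AbsoluteAnabelian.AbsTopIProp23iHyperbolicModelProofs
import HarnessLib

/-!
# [AbsTopI] Prop 2.3 (ii) at the FULL surface-group model: `Π` slim, not elastic, for EVERY
# hyperbolic type `(g, r)` — the residual inputs of `arithSlimNotElastic'` DISCHARGED BY NAME

S. Mochizuki, *Topics in Absolute Anabelian Geometry I: Generalities* (2012) [AbsTopI], Prop 2.3 (ii),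
kurims manuscript p. 19 (lit key `paper:url-11ac98ba15fc`): "(ii) Let `1 → Δ → Π → G → 1` be an
extension of GSAFG-type that admits partial construction data `(k, X, Σ)` [...], where `X` is a
hyperbolic orbicurve, and `k` is either an MLF or an NF. Then `Π` is slim, but not elastic."  Proof
(p. 19): "The slimness portion of assertion (ii) follows immediately from the slimness portion of
assertion (i), together with the slimness portion of Theorem 1.7, (ii), (iii); the fact that `Π` is
not elastic follows from the existence of the nontrivial, topologically finitely generated [cf.
Proposition 2.2], closed, normal, infinite index subgroup `Δ ⊆ Π`."

abc-iut row «P23II-INPUTS» (abc-iut-L4-lead, 09:3xZ; seat abc-iut-L4-t4, typer of record of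
`FundamentalExtension.ArithSlimNotElastic`, DAG node AbsTopI:Prop2.3(ii), FACT-LIST F-0238).  The
lineage's reduction `MLFBase.arithSlimNotElastic'` / `NFBase.arithSlimNotElastic'`
(`AbsTopIProp23InfiniteIndexProofs.lean`, p422288) left exactly three printed inputs on `Δ`: `Δ`
slim (Prop 2.3 (i)), `Δ ≠ 1` ("nontrivial"), `Δ` topologically finitely generated (Prop 2.2) — the
slimness of `G` being the tree's theorem (`galoisMLF_slim_holds` / `galoisNF_slim_holds`,
`AbsTopIProp23SlimProofs.lean`) and the infinite index of `Δ` PROVED (p422288).  All three inputs are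
now theorems of the tree AT THE SURFACE-GROUP MODEL of a hyperbolic (orbi)curve of type `(g, r)`,
`2g − 2 + r > 0`, `Δ` presented as a pro-`Σ` completion `ι : Γ_{g,r} → Δ` (abc-iut-L3's
`IsProSigmaCompletion`): topological finite generation `geomTFG_of_isProSigmaCompletion_puncturedSurfaceGroup`
(abc-iut-L4-d1), slimness `isSlimGroup_geom_of_isProSigmaCompletion_hyperbolic` (Prop 2.3 (i) junction,
abc-iut-w6-d071), nontriviality `geom_ne_bot_of_isProSigmaCompletion_closedSurfaceGroup` (`r = 0`,
abc-iut-L4-d1) / `…_puncturedSurfaceGroup` (`r ≥ 1`, abc-iut-w5-d206).  This proof-only file JOINS the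
two cases (`r = 0` of p424656 and `r ≥ 1` of p428005) into the statements for EVERY hyperbolic type:

* `geom_ne_bot_of_isProSigmaCompletion_hyperbolic` — `Δ ≠ 1`;
* `arithSlimNotElastic_of_isProSigmaCompletion_hyperbolic_mlf` / `_nf` — **Prop 2.3 (ii) HOLDS** for
  every extension with MLF (resp. NF) base data whose `Δ` is a pro-`Σ` completion of `Γ_{g,r}`,
  `(g, r)` hyperbolic, `Σ` a nonempty set of primes — no residual hypothesis;
* `prop22_prop23_of_isProSigmaCompletion_hyperbolic_mlf` / `_nf` — the triple
  `GeomTFG ∧ GeomSlimElastic ∧ ArithSlimNotElastic` (Prop 2.2, 2.3 (i), 2.3 (ii)) at every hyperbolic type.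

No definition, no named fact.  HONEST FRAMING: MODEL-level (the pro-`Σ` surface-group presentation of
`Δ` is the hypothesis that the étale-`π₁` construction of campaign L supplies); the abstract predicate
over an arbitrary `FundamentalExtension` stays what it is (its universal closure is refuted,
`AbsTopISemiAbsoluteClosures`); nothing here bears on [IUTchIII] Cor. 3.12.
-/

noncomputable section

namespace Literature.AnabelianGeometry.AbsoluteAnabelian.FundamentalExtension

open Literature.AnabelianGeometry.SemiGraphs.SemiGraphOfAnabelioids
open Literature.GroupTheory.CombinatorialGroupTheory

variable {E : FundamentalExtension.{0}} {Sigma : Set ℕ} {g r : ℕ}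

/-- **`Δ ≠ 1` at every hyperbolic type**: for `Δ` a pro-`Σ` completion of `Γ_{g,r}` with
`2g − 2 + r > 0` and `Σ` containing a prime, `Δ` is nontrivial (`r = 0`: `δ¹_ℓ(Δ) = 2g ≥ 4`,
abc-iut-L4-d1; `r ≥ 1`: free of rank `2g + r − 1 ≥ 2`, abc-iut-w5-d206).
[cite: MochizukiAbsTopI2012, Prop 2.3 (ii) p.19] -/
theorem geom_ne_bot_of_isProSigmaCompletion_hyperbolic (E : FundamentalExtension.{0})
    (hS : ∃ ℓ ∈ Sigma, ℓ.Prime) (hgr : PuncturedSurfaceGroup.IsHyperbolicType g r)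
    (ι : PuncturedSurfaceGroup g r →* E.geom) (hι : IsProSigmaCompletion Sigma ι) : E.geom ≠ ⊥ := by
  rcases Nat.eq_zero_or_pos r with hr | hr
  · subst hr
    exact E.geom_ne_bot_of_isProSigmaCompletion_closedSurfaceGroup hS
      (two_le_genus_of_isHyperbolicType_zero hgr) ι hι
  · exact E.geom_ne_bot_of_isProSigmaCompletion_puncturedSurfaceGroup hS hr hgr ι hι

/-- **[AbsTopI] Prop 2.3 (ii) at the surface-group model, MLF base, EVERY hyperbolic type** — "`Π` is
slim, but not elastic": for an extension `1 → Δ → Π → G → 1` with MLF base data `G ≅ G_k` whose `Δ`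
is a pro-`Σ` completion of `Γ_{g,r}`, `2g − 2 + r > 0`, `Σ` a nonempty set of primes, the typed
predicate `ArithSlimNotElastic` HOLDS — the three residual inputs of abc-iut-L4-t4's
`MLFBase.arithSlimNotElastic'` (`Δ` slim / `≠ 1` / topologically finitely generated) discharged BY NAME.
[cite: MochizukiAbsTopI2012, Prop 2.3 (ii) p.19] -/
theorem arithSlimNotElastic_of_isProSigmaCompletion_hyperbolic_mlf (B : E.MLFBase)
    (hS : Sigma.Nonempty) (hSp : ∀ p ∈ Sigma, p.Prime) (hgr : PuncturedSurfaceGroup.IsHyperbolicType g r)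
    (ι : PuncturedSurfaceGroup g r →* E.geom) (hι : IsProSigmaCompletion Sigma ι) :
    E.ArithSlimNotElastic := by
  obtain ⟨ℓ, hℓS⟩ := hS
  exact B.arithSlimNotElastic'
    (E.isSlimGroup_geom_of_isProSigmaCompletion_hyperbolic ⟨ℓ, hℓS⟩ hSp hgr ι hι)
    (E.geom_ne_bot_of_isProSigmaCompletion_hyperbolic ⟨ℓ, hℓS, hSp ℓ hℓS⟩ hgr ι hι)
    (E.geomTFG_of_isProSigmaCompletion_puncturedSurfaceGroup ι hι)

/-- **[AbsTopI] Prop 2.3 (ii) at the surface-group model, NF base, EVERY hyperbolic type** (same for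
extensions with number-field base data `G ≅ G_F`). [cite: MochizukiAbsTopI2012, Prop 2.3 (ii) p.19] -/
theorem arithSlimNotElastic_of_isProSigmaCompletion_hyperbolic_nf (B : E.NFBase)
    (hS : Sigma.Nonempty) (hSp : ∀ p ∈ Sigma, p.Prime) (hgr : PuncturedSurfaceGroup.IsHyperbolicType g r)
    (ι : PuncturedSurfaceGroup g r →* E.geom) (hι : IsProSigmaCompletion Sigma ι) :
    E.ArithSlimNotElastic := by
  obtain ⟨ℓ, hℓS⟩ := hS
  exact B.arithSlimNotElastic'
    (E.isSlimGroup_geom_of_isProSigmaCompletion_hyperbolic ⟨ℓ, hℓS⟩ hSp hgr ι hι)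
    (E.geom_ne_bot_of_isProSigmaCompletion_hyperbolic ⟨ℓ, hℓS, hSp ℓ hℓS⟩ hgr ι hι)
    (E.geomTFG_of_isProSigmaCompletion_puncturedSurfaceGroup ι hι)

/-- **[AbsTopI] Prop 2.2 + 2.3 (i) + 2.3 (ii) at the surface-group model, MLF base, every hyperbolic
type**: `Δ` topologically finitely generated, `Δ` slim and elastic, `Π` slim but not elastic.
[cite: MochizukiAbsTopI2012, Prop 2.3 p.19] -/
theorem prop22_prop23_of_isProSigmaCompletion_hyperbolic_mlf (B : E.MLFBase) (hS : Sigma.Nonempty)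
    (hSp : ∀ p ∈ Sigma, p.Prime) (hgr : PuncturedSurfaceGroup.IsHyperbolicType g r)
    (ι : PuncturedSurfaceGroup g r →* E.geom) (hι : IsProSigmaCompletion Sigma ι) :
    E.GeomTFG ∧ E.GeomSlimElastic ∧ E.ArithSlimNotElastic :=
  ⟨E.geomTFG_of_isProSigmaCompletion_puncturedSurfaceGroup ι hι,
    E.geomSlimElastic_of_isProSigmaCompletion_hyperbolic hS hSp hgr ι hι,
    arithSlimNotElastic_of_isProSigmaCompletion_hyperbolic_mlf B hS hSp hgr ι hι⟩

/-- **[AbsTopI] Prop 2.2 + 2.3 (i) + 2.3 (ii) at the surface-group model, NF base, every hyperbolic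
type.** [cite: MochizukiAbsTopI2012, Prop 2.3 p.19] -/
theorem prop22_prop23_of_isProSigmaCompletion_hyperbolic_nf (B : E.NFBase) (hS : Sigma.Nonempty)
    (hSp : ∀ p ∈ Sigma, p.Prime) (hgr : PuncturedSurfaceGroup.IsHyperbolicType g r)
    (ι : PuncturedSurfaceGroup g r →* E.geom) (hι : IsProSigmaCompletion Sigma ι) :
    E.GeomTFG ∧ E.GeomSlimElastic ∧ E.ArithSlimNotElastic :=
  ⟨E.geomTFG_of_isProSigmaCompletion_puncturedSurfaceGroup ι hι,
    E.geomSlimElastic_of_isProSigmaCompletion_hyperbolic hS hSp hgr ι hι,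
    arithSlimNotElastic_of_isProSigmaCompletion_hyperbolic_nf B hS hSp hgr ι hι⟩

end Literature.AnabelianGeometry.AbsoluteAnabelian.FundamentalExtension

end
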